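import Summits.NavierStokesRegularity.NavierStokesRegularity.Theorems.PerpetualPumpAveragedTypeIBlowupSynthMildTools

/-!
# Crux `PerpetualPump.AveragedTypeIBlowup` (stmt-NavierStokesRegularity-1835), line `Sketch`:
# stub `synthMild` — the wavelet Duhamel series of a chain solution is a mild solution with those coefficients

T. Tao, *Finite time blowup for an averaged three-dimensional Navier–Stokes equation*, J. Amer.
Math. Soc. **29** (2016), 601–674 = arXiv:1402.0290v3, §4, proof of Lemma 4.1, p. 22, (4.14)–(4.15):
"As `u` is a mild solution to (3.3), we have
`u(t) = e^{tΔ}u₀ + Σ α (1+ε₀)^{5n/2} ∫₀ᵗ X_{i₁,n+μ₁} X_{i₂,n+μ₂}(t') e^{(t-t')Δ} ψ_{i₃,n+μ₃} dt'` (4.14) …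
Taking inner products of (4.14) with `ψ_{i,n}` …". This file runs that computation BACKWARDS
(synthesis): it is handed a continuous solution `Y` on `[0,S)` of the exact Volterra chain
`Y_{i,n}(t) = A 1_{(i,n)=(i₀,n₀)} Re⟨e^{tΔ}ψ_{i,n}, ψ_{i,n}⟩ + ∫₀ᵗ Re⟨e^{(t-s)Δ}ψ_{i,n}, ψ_{i,n}⟩ quadTerm(Y)_{i,n}(s) ds`
(no modes below `n₀`, decay `(1+ε₀)^{20n}|Y_{i,n}| ≤ C` on compact sub-intervals) and an `H¹⁰_df`-valued,
`H¹⁰`-continuous field `u` whose pairings expand as the wavelet Duhamel series (4.14) of `Y`,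
`⟨u(t), w⟩ - ⟨e^{tΔ}(Aψ_{i₀,n₀}), w⟩ = Σ_{(i,n)} ∫₀ᵗ quadTerm(Y)_{i,n}(s) ⟨e^{(t-s)Δ}ψ_{i,n}, w⟩ ds` (all `w ∈ L²`),
and proves the registered stub `stub_synthMild` of the line's skeleton, verbatim: `u` is a mild solution
of the cascade equation (3.3)/(4.1) on `[0,S)` with datum `Aψ_{i₀,n₀}`, and its mode coefficients
`X_{i,n} = Re⟨u, ψ_{i,n}⟩` are the `Y_{i,n}`.

* `pairing_eq_of_hasSum_wavelet` — testing the series with `w = ψ_{j,k}` collapses it (the heat flow keeps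
  the wavelets Fourier-disjoint, `pairing_heat_cascadeWavelet_of_ne`) to the right-hand side of the chain,
  so `⟨u(t), ψ_{j,k}⟩ = Y_{j,k}(t)` as complex numbers (the heat kernel of a mode is real).
* `stub_synthMild` — with these coefficients, `⟨C(u(s),u(s)), e^{(t-s)Δ}w⟩` regroups by output mode into
  `Σ_{(i,n)} quadTerm(Y)_{i,n}(s) ⟨e^{(t-s)Δ}ψ_{i,n}, w⟩` (`cascadeOperatorForm_eq_tsum_quadTerm_of_le_one`,
  absolutely summable scale series under the weighted bound `weighted_abs_le_of_decay`; `e^{(t-s)Δ}` is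
  self-adjoint and the pairing symmetric), and `Σ_{(i,n)}` and `∫₀ᵗ` are exchanged by dominated convergence
  (`hasSum_integral_duhamelTerms_of_continuousOn`, majorant `K b_n ‖w‖` from (4.8)); uniqueness of sums.

Nothing here closes the item (`--supports`); no statement of the route changes.

## References

* T. Tao, J. Amer. Math. Soc. 29 (2016), 601–674, arXiv:1402.0290v3, §4 Lemma 4.1, p. 22
  ((4.14), (4.15)). [`Tao2016AveragedNS`]
-/

noncomputable section

-- the summit namespace `…NavierStokesRegularity.NavierStokesRegularity…` is the tree convention
set_option linter.dupNamespace false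

open MeasureTheory Set Filter Topology
open scoped ENNReal
open Literature.Analysis.FluidPDE Literature.Analysis.FluidPDE.Tao2016
open Literature.Analysis.FluidPDE.TaoCascade (quadTerm IsSymmetricCoeff IsCancellingCoeff)
-- summability of the mode bounds (sibling route item `PumpTransfer`)
open Summit.NavierStokesRegularity.NavierStokesRegularity.Theorems.PerpetualPumpPumpTransfer
  (summable_fibreBound)

namespace Summit.NavierStokesRegularity.NavierStokesRegularity.Theorems.PerpetualPumpAveragedTypeIBlowup

variable {ε₀ : ℝ} {m : ℕ}

/-! ### Testing the Duhamel series with a wavelet -/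

/-- **Testing the wavelet Duhamel series with `ψ_{j,k}` collapses it to the chain**: if
`⟨v, ψ_{j,k}⟩ - ⟨e^{tΔ}(Aψ_{i₀,n₀}), ψ_{j,k}⟩ = Σ_p ∫₀ᵗ Q_p(s) ⟨e^{(t-s)Δ}ψ_p, ψ_{j,k}⟩ ds`, then
`⟨v, ψ_{j,k}⟩ = A 1_{(j,k)=(i₀,n₀)} Re⟨e^{tΔ}ψ_{j,k}, ψ_{j,k}⟩ + ∫₀ᵗ Re⟨e^{(t-s)Δ}ψ_{j,k}, ψ_{j,k}⟩ Q_{j,k}(s) ds`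
(only the term `p = (j,k)` survives, "taking inner products of (4.14) with `ψ_{i,n}`", p. 22; the
heat kernel of a mode is real). [cite: Tao2016AveragedNS, §4 (4.14)] -/
theorem pairing_eq_of_hasSum_wavelet (hε₀ : 0 < ε₀) (𝒟 : CascadeWaveletData ε₀ m)
    (Q : Fin m × ℤ → ℝ → ℝ) (i₀ : Fin m) (n₀ : ℤ) (A t : ℝ) (v : L2C) (j : Fin m) (k : ℤ)
    (h : HasSum (fun p : Fin m × ℤ => ∫ s in (0 : ℝ)..t, ((Q p s : ℝ) : ℂ) *
        pairing (heat (t - s) (cascadeWavelet ε₀ (𝒟.ψ p.1) p.2)) (cascadeWavelet ε₀ (𝒟.ψ j) k))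
      (pairing v (cascadeWavelet ε₀ (𝒟.ψ j) k) -
        pairing (heat t ((A : ℂ) • cascadeWavelet ε₀ (𝒟.ψ i₀) n₀)) (cascadeWavelet ε₀ (𝒟.ψ j) k))) :
    pairing v (cascadeWavelet ε₀ (𝒟.ψ j) k) =
      (((if j = i₀ ∧ k = n₀ then A else 0) *
          (pairing (heat t (cascadeWavelet ε₀ (𝒟.ψ j) k)) (cascadeWavelet ε₀ (𝒟.ψ j) k)).re +
        ∫ s in (0 : ℝ)..t, (pairing (heat (t - s) (cascadeWavelet ε₀ (𝒟.ψ j) k))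
          (cascadeWavelet ε₀ (𝒟.ψ j) k)).re * Q (j, k) s : ℝ) : ℂ) := by
  -- only the term `p = (j,k)` of the series is nonzero
  have hzero : ∀ p : Fin m × ℤ, p ≠ (j, k) → (∫ s in (0 : ℝ)..t, ((Q p s : ℝ) : ℂ) *
      pairing (heat (t - s) (cascadeWavelet ε₀ (𝒟.ψ p.1) p.2)) (cascadeWavelet ε₀ (𝒟.ψ j) k)) = 0 := by
    intro p hp
    have h0 : ∀ s : ℝ, ((Q p s : ℝ) : ℂ) *
        pairing (heat (t - s) (cascadeWavelet ε₀ (𝒟.ψ p.1) p.2)) (cascadeWavelet ε₀ (𝒟.ψ j) k) = 0 :=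
      fun s => by
        rw [pairing_heat_cascadeWavelet_of_ne hε₀ 𝒟 (t - s)
          (fun h' => hp (Prod.ext (Prod.mk.inj h').1 (Prod.mk.inj h').2)), mul_zero]
    simp only [h0, intervalIntegral.integral_zero]
  have h1 : pairing v (cascadeWavelet ε₀ (𝒟.ψ j) k) -
      pairing (heat t ((A : ℂ) • cascadeWavelet ε₀ (𝒟.ψ i₀) n₀)) (cascadeWavelet ε₀ (𝒟.ψ j) k) =
        ∫ s in (0 : ℝ)..t, ((Q (j, k) s : ℝ) : ℂ) *
          pairing (heat (t - s) (cascadeWavelet ε₀ (𝒟.ψ j) k)) (cascadeWavelet ε₀ (𝒟.ψ j) k) :=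
    h.unique (hasSum_single (j, k) hzero)
  -- the datum term: `⟨e^{tΔ}(Aψ_{i₀,n₀}), ψ_{j,k}⟩ = A 1_{(j,k)=(i₀,n₀)} ⟨e^{tΔ}ψ_{j,k}, ψ_{j,k}⟩`
  have hdat : pairing (heat t ((A : ℂ) • cascadeWavelet ε₀ (𝒟.ψ i₀) n₀)) (cascadeWavelet ε₀ (𝒟.ψ j) k) =
      (((if j = i₀ ∧ k = n₀ then A else 0 : ℝ) : ℝ) : ℂ) *
        pairing (heat t (cascadeWavelet ε₀ (𝒟.ψ j) k)) (cascadeWavelet ε₀ (𝒟.ψ j) k) := by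
    rw [show heat t ((A : ℂ) • cascadeWavelet ε₀ (𝒟.ψ i₀) n₀) =
        (A : ℂ) • heat t (cascadeWavelet ε₀ (𝒟.ψ i₀) n₀) from fourierMultiplier_smul _ _ _,
      pairing_smul_left]
    split_ifs with hq
    · obtain ⟨rfl, rfl⟩ := hq
      rfl
    · rw [pairing_heat_cascadeWavelet_of_ne hε₀ 𝒟 t (fun h' => hq ?_), mul_zero, Complex.ofReal_zero,
        zero_mul]
      exact ⟨(Prod.mk.inj h').1.symm, (Prod.mk.inj h').2.symm⟩
  -- the heat kernel of the mode is real
  have hre : ∀ τ : ℝ, (((pairing (heat τ (cascadeWavelet ε₀ (𝒟.ψ j) k)) (cascadeWavelet ε₀ (𝒟.ψ j) k)).re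
      : ℝ) : ℂ) = pairing (heat τ (cascadeWavelet ε₀ (𝒟.ψ j) k)) (cascadeWavelet ε₀ (𝒟.ψ j) k) :=
    fun τ => (pairing_heat_cascadeWavelet_self_eq_ofReal 𝒟 τ j k).symm
  rw [sub_eq_iff_eq_add'] at h1
  rw [h1, hdat]
  push_cast
  rw [← intervalIntegral.integral_ofReal]
  simp only [Complex.ofReal_mul, hre]
  congr 1
  exact intervalIntegral.integral_congr fun s _ => mul_comm _ _

/-! ### The stub -/

/-- **Stub `synthMild`.** A field as in `stub_synthField` is a mild solution of the cascade equation (3.3) on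
`[0,S)` with datum `A ψ_{i₀,n₀}`, and its mode coefficients are the chain solution: testing with `ψ_{j,k}`
collapses the series to the chain identity (disjoint supports), and `⟨C(u,u), e^{(t-s)Δ}w⟩` regroups by output
mode into `Σ_{i,n} quadTerm(Y)_{i,n}(s) ⟨e^{(t-s)Δ}ψ_{i,n}, w⟩`. [cite: Tao2016AveragedNS, §4 p. 22 (4.14)–(4.15)] -/
theorem stub_synthMild :
    ∀ {ε₀ : ℝ}, 0 < ε₀ → ε₀ ≤ 1 → ∀ {m : ℕ} (𝒟 : CascadeWaveletData ε₀ m)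
      (α : Fin m → Fin m → Fin m → ℤ × ℤ × ℤ → ℝ) (i₀ : Fin m) (n₀ : ℤ) (A S : ℝ)
      (Y : Fin m → ℤ → ℝ → ℝ), 0 < S →
      (∀ i n, ContinuousOn (Y i n) (Ico 0 S)) →
      (∀ i n t, n < n₀ → Y i n t = 0) →
      (∀ S' : ℝ, S' < S → ∃ C : ℝ, ∀ (i : Fin m) (n : ℤ), ∀ t ∈ Icc 0 S',
        (1 + ε₀) ^ ((20 : ℝ) * n) * |Y i n t| ≤ C) →
      (∀ (i : Fin m) (n : ℤ), ∀ t ∈ Ico 0 S,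
        Y i n t = (if i = i₀ ∧ n = n₀ then A else 0) *
            (pairing (heat t (cascadeWavelet ε₀ (𝒟.ψ i) n)) (cascadeWavelet ε₀ (𝒟.ψ i) n)).re +
          ∫ s in (0 : ℝ)..t,
            (pairing (heat (t - s) (cascadeWavelet ε₀ (𝒟.ψ i) n)) (cascadeWavelet ε₀ (𝒟.ψ i) n)).re *
              quadTerm ε₀ α Y i n s) →
      ∀ u : ℝ → L2C, (∀ t ∈ Ico 0 S, MemH10df (u t)) → ContinuousInH10On (Ico 0 S) u →
        (∀ t ∈ Ico 0 S, ∀ w : L2C,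
          HasSum (fun p : Fin m × ℤ => ∫ s in (0 : ℝ)..t,
              (quadTerm ε₀ α Y p.1 p.2 s : ℂ) * pairing (heat (t - s) (cascadeWavelet ε₀ (𝒟.ψ p.1) p.2)) w)
            (pairing (u t) w - pairing (heat t ((A : ℂ) • cascadeWavelet ε₀ (𝒟.ψ i₀) n₀)) w)) →
        IsMildSolutionFor (cascadeOperatorForm ε₀ 𝒟.ψ α) ((A : ℂ) • cascadeWavelet ε₀ (𝒟.ψ i₀) n₀)
            (Ico 0 S) u ∧
          ∀ (i : Fin m) (n : ℤ), ∀ t ∈ Ico 0 S, modeCoeff 𝒟 u i n t = Y i n t := by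
  intro ε₀ hε₀ hε₁ m 𝒟 α i₀ n₀ A S Y _hS hcont hlow hdec hchain u hmem hcts hsum
  have hε' : 0 < 1 + ε₀ := by linarith
  -- Step 1: the coefficients of `u(t)` are the `Y_{j,k}(t)`, as complex numbers
  have hcoefC : ∀ t ∈ Ico (0 : ℝ) S, ∀ (j : Fin m) (k : ℤ),
      pairing (u t) (cascadeWavelet ε₀ (𝒟.ψ j) k) = ((Y j k t : ℝ) : ℂ) := by
    intro t ht j k
    rw [pairing_eq_of_hasSum_wavelet hε₀ 𝒟 (fun p s => quadTerm ε₀ α Y p.1 p.2 s) i₀ n₀ A t (u t) j k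
      (hsum t ht _), hchain j k t ht]
  refine ⟨⟨hmem, hcts, fun t ht w _hw => ?_⟩, fun i n t ht => ?_⟩
  swap
  · rw [modeCoeff, hcoefC t ht i n, Complex.ofReal_re]
  -- Step 2: the mild identity at `t ∈ [0,S)` tested with `w`
  have ht0 : (0 : ℝ) ≤ t := ht.1
  have hIcc : ∀ s ∈ Icc (0 : ℝ) t, s ∈ Ico (0 : ℝ) S := fun s hs => ⟨hs.1, hs.2.trans_lt ht.2⟩
  -- the weighted coefficient bound on `[0,t]` and the mode bounds `K b_n` of the forcings
  obtain ⟨C, hC⟩ := hdec t ht.2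
  set C' : ℝ := C * ((1 + ε₀) ^ (-(20 : ℝ) * n₀) + (1 + ε₀) ^ (-(10 : ℝ) * n₀)) with hC'
  have hX : ∀ s ∈ Icc (0 : ℝ) t, ∀ (j : Fin m) (k : ℤ), (1 + ((1 + ε₀) ^ k) ^ 10) * |Y j k s| ≤ C' :=
    fun s hs j k => weighted_abs_le_of_decay hε₀ hlow (fun i n => hC i n s hs) j k
  set K : ℝ := (∑ i₃ : Fin m, ∑ i₁ : Fin m, ∑ i₂ : Fin m, ∑ μ ∈ TaoCascade.shiftSet, |α i₁ i₂ i₃ μ|) *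
    (2 ^ 10 * C') ^ 2 with hK
  set b : ℤ → ℝ := fun n => (((1 + ε₀) ^ n) ^ 2 + ((1 + ε₀) ^ n) ^ 3) / (1 + ((1 + ε₀) ^ n) ^ 10) ^ 2
    with hb
  have hbsum : Summable fun p : Fin m × ℤ => b p.2 := summable_fibreBound (by linarith) m
  have hQb : ∀ p : Fin m × ℤ, ∀ s ∈ Icc (0 : ℝ) t, |quadTerm ε₀ α Y p.1 p.2 s| ≤ K * b p.2 := by
    intro p s hs
    refine (abs_quadTerm_le_of_le_one hε₀ hε₁ α Y (hX s hs) p.1 p.2).trans (le_of_eq ?_)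
    simp only [hK, hb, div_pow]
    ring
  have hQc : ∀ p : Fin m × ℤ, ContinuousOn (fun s => quadTerm ε₀ α Y p.1 p.2 s) (Icc 0 t) := by
    intro p
    have hY : ∀ (j : Fin m) (k : ℤ), ContinuousOn (Y j k) (Icc 0 t) :=
      fun j k => (hcont j k).mono fun s hs => hIcc s hs
    simp only [quadTerm]
    refine continuousOn_finsetSum _ fun i₁ _ => continuousOn_finsetSum _ fun i₂ _ =>
      continuousOn_finsetSum _ fun μ _ => ?_
    exact continuousOn_const.mul ((hY _ _).mul (hY _ _))
  -- (2b) the mode sum and the time integral are exchanged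
  have hR := hasSum_integral_duhamelTerms_of_continuousOn hε' 𝒟 hQc (hbsum.mul_left K) hQb w
  -- the given expansion of `⟨u(t), w⟩`, with the time integrals over `Ioc 0 t`
  have hL := hsum t ht w
  simp only [intervalIntegral.integral_of_le ht0] at hL
  have hId : pairing (u t) w - pairing (heat t ((A : ℂ) • cascadeWavelet ε₀ (𝒟.ψ i₀) n₀)) w =
      ∫ s in Ioc (0 : ℝ) t, ∑' p : Fin m × ℤ, ((quadTerm ε₀ α Y p.1 p.2 s : ℝ) : ℂ) *
        pairing (heat (t - s) (cascadeWavelet ε₀ (𝒟.ψ p.1) p.2)) w :=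
    hL.unique hR
  -- (2a) the cascade operator regrouped by output mode, for `s ∈ (0,t]`
  have hCeq : ∫ s in (0 : ℝ)..t, cascadeOperatorForm ε₀ 𝒟.ψ α (u s) (u s) (heat (t - s) w) =
      ∫ s in Ioc (0 : ℝ) t, ∑' p : Fin m × ℤ, ((quadTerm ε₀ α Y p.1 p.2 s : ℝ) : ℂ) *
        pairing (heat (t - s) (cascadeWavelet ε₀ (𝒟.ψ p.1) p.2)) w := by
    rw [intervalIntegral.integral_of_le ht0]
    refine setIntegral_congr_fun measurableSet_Ioc fun s hs => ?_
    have hsI : s ∈ Icc (0 : ℝ) t := ⟨hs.1.le, hs.2⟩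
    rw [cascadeOperatorForm_eq_tsum_quadTerm_of_le_one hε₀ hε₁ 𝒟 α Y (hX s hsI) (hcoefC s (hIcc s hsI))]
    refine tsum_congr fun p => ?_
    rw [pairing_heat_left (t - s) w, pairing_swap w]
  rw [hCeq, ← hId]
  ring

end Summit.NavierStokesRegularity.NavierStokesRegularity.Theorems.PerpetualPumpAveragedTypeIBlowup

end
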